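/-
Copyright: statement-level skeleton of a published paper (lit-balaban cell, Phase-2 proof seat p27, gen 31). No proof claims
beyond what the kernel checks below.
-/
import Mathlib
import Literature.MathematicalPhysics.QuantumFieldTheory.BalabanImbrieJaffe1984to88.BIJ85Eq7113DerivationPart5

/-!
# `BalabanImbrieJaffe1984to88.BIJ85Eq7113ClosedCubeMinimiser` — T. Bałaban, J. Imbrie, A. Jaffe, *Renormalization of the Higgs
model: minimizers, propagators and the stability of mean field theory*, Commun. Math. Phys. **97** (1985) 299–329 [BalabanImbrieJaffe1985]:
Sect. 7.1 p. 322, (7.1.12) ⟹ (7.1.13) — **THE MINIMISER OF THE FIBRE PROBLEM ON THE CLOSED MOMENTUM CUBE**: seat p10's explicit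
minimiser `A* = B₀ − A₁ − ∂λ` of `‖∂A − Q^{e*}_kf‖²` over `{Q_kA = 0}` (`BIJ85Eq7113Derivation.minimiser`, built at the GENERIC fibres from
the printed symbols (7.1.7)–(7.1.16)) rebuilt on p10's closed-cube symbols (`vC`, `uC`, `aC`, `phiC`, `rC`, `wC`: removable
singularities filled) — `minimiserC`; it AGREES with `minimiser` at every momentum with all components non-zero, is CONTINUOUS on the
regular set, and therefore (density of the generic momenta along p10's `fillPath`) is `Q_k`-CONSTRAINED and has energy
`‖∂A* − Q^{e*}_kf‖² = Re⟨f, σ^C_k(p′)f⟩` (p10's regularized (7.1.13)–(7.1.16) `BIJ85SigmaClosedCube.sigmaC = tau1C + tau2C`) at EVERY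
`p′ ≠ 0` of the closed cube `|p′_j| ≤ π` — the AXIS FIBRES included (file 2 of 3 of the axis-fibre completion of rows
C1.Eq7.1.2-7.1.12 / C1.Eq7.1.13-7.1.19; file 1 `BIJ85Tau1ClosedCube` = τ₁, file 3 `BIJ85Eq7113AxisFibres` = the constrained minimum and
the σ_k/τ₂ of record)

statement-level skeleton of published theorems with citation tags; proofs where landed; nothing here is a claim about
the Yang–Mills mass gap

PDF held: `paper:balaban1985-cmp97-bij-higgs-minimizers` (journal page = PDF page + 298); pp. 322–324 [PDF 24–26] re-read as images
(`run/shared/lean/pub/pub-balaban/t4/b2b-balaban-t4-lit2/renders/bij1985/1985-cmp97-bij-higgs-minimizers-p024-x2.png` …).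

THE PRINTED TEXT (verbatim, p. 322).  *"The basic object we wish to study is σ_k, defined in (4.2.2), σ_k = Q^e_k(I − ∂G_{k,Ax}∂^*)Q^{e*}_k.
(7.1.12) … Starting from this expression, one can derive the following formulas for σ_k(p) by straightforward, algebraic
manipulation: We express σ_k as a sum of two terms σ_k = τ₁ + τ₂. (7.1.13)"*; p. 324: *"c ≤ σ_k(p) (7.1.22) for all |p_j| ≤ π"* — the
closed cube.  The printed symbols (7.1.7) `v_μ = ∂^{(1)}_μ/∂_μ`, (7.1.10) `φ_μ`, (7.1.14)–(7.1.16) are `0/0` on the axis fibres (GAPS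
G-C1-03); p10's `BIJ85SigmaClosedCube` fills the removable singularities and proved the INEQUALITY (7.1.22) there by continuity
(`BIJ85Thm711ClosedCube`, `BIJ85Eq7113DerivationPart5`: *"NOT CLAIMED: the identification of the closed-cube minimum with ⟨f, σ^C_k(p)f⟩
… at the non-generic fibres (only the inequality is transported)"*).  This file transports the MINIMISER itself.

CITATION HEADER (lean-in-tree rule).  Part of the lit-balaban TYPED SKELETON (HOME `run/shared/lean/pub/lit-balaban/`), Phase-2 seat p27
(gen 31), unit `lit-balaban-p27`; rows **C1.Eq7.1.2-7.1.12**, **C1.Eq7.1.13-7.1.19** (fold owner r15, referee ref-5); r15's `C1-CLOSURE.md`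
§5 item 1.  INPUTS (all landed, by name): p10's `BIJ85Eq7113Derivation` (`minimiser` and its parts `bZero`, `xVec`, `yVec`, `zVec`, `cVec`,
`aOne`, `sPar`, `gaugeF`; `qOp_minimiser`), `…Part3` (`energy_minimiser`, `generic_scale`), `…Part5` (`rC`, `wC`, `qeStarC`, `qOpC`,
`energyC`, `rC_eq_rQ`, `wC_eq_wE`, `qOpC_eq_qOp`, `energyC_eq_energy`), `BIJ85SigmaClosedCube` (`aC`, `phiC`, `sigmaC`, `regSet`,
`fillPath`, agreement lemmas), `BIJ85Thm711ClosedCube` (`continuousOn_form`, `mem_regSet`); gen-2 `BIJ85Tau2Kernel715` (`scl`, `hVec`,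
`sqrtInv`, `enn`), `BIJ85CurlComplement719.projK`.
WHAT IS TYPED (defs with bodies, §1; `η = 1/n`): `bZeroC` (B₀ = Δ⁻¹∂^*Q^{e*}_kf with the edge weight `wC`), `xVecC` (∂^{(1)}/√φ^C),
`yVecC`, `zVecC`, `cVecC`, `aOneC` (A₁ = Δ⁻¹Q_k^*c with the bond weight `rC`), `sParC`, `gaugeFC` (λ(0) = s/u^C(p′)), `minimiserC` — each
LITERALLY p10's formula with (`phiSym`, `aSym`, `rQ`, `uSym`, `qeStar`) ↦ (`phiC`, `aC`, `rC`, `uC`, `qeStarC`).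
WHAT IS PROVED (zero `sorry`, standard axioms): §2 AGREEMENT at generic momenta (`0 < n`, all `p′_i ≠ 0`, `|p′_i| ≤ π`, two-forms `f`):
`qeStarC_eq_qeStar`, `bZeroC_eq`, `xVecC_eq`, …, **`minimiserC_eq_minimiser`**; hence there `Q^C_k(minimiserC) = 0` and
`‖∂A* − Q^{e*}_kf‖²_C = Re⟨f, σ^C_k f⟩` (`qOpC_minimiserC_generic`, `energyC_minimiserC_generic`, via p10's `qOp_minimiser`/`energy_minimiser`
and `sigmaC_form_eq`); §3 CONTINUITY in `p′` on the regular set `regSet ∩ {u^C(p′) ≠ 0}` (⊇ the punctured closed cube) of every part and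
of `p′ ↦ Q^C_k(A*(p′))`, `p′ ↦ ‖∂A*(p′) − Q^{e*}_kf‖²_C`; §4 the DENSITY DEVICE along p10's path `fillPath p′ t` (generic for `t ∈ (0, π]`,
`→ p′` as `t → 0⁺`): `tendsto_fillPath_nhdsWithin`, `eq_of_fillPath`, `le_of_fillPath`; §5 **`qOpC_minimiserC`** and **`energyC_minimiserC`**
for EVERY `p′ ≠ 0` of the closed cube (any `Scale`: `η = 1/n`, cut-off `M`, `2M + 1 ≤ n`; `0 < d`), and **`exists_constrained_energyC_eq_form`**.
HONEST SCOPE: `p′ = 0` is NOT covered here (there `Δ(p′) = 0`, `φ^C` and `N` degenerate; file 3 treats it directly: the constraint reads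
`A(0) = 0` and `τ₂^C(0) = 0`); the identification with the σ_k OF RECORD is file 3 (via this seat's gen-6 `fibreMin` dictionary).
-/

namespace Literature.MathematicalPhysics.QuantumFieldTheory.BalabanImbrieJaffe1984to88.BIJ85Eq7113ClosedCubeMinimiser

open scoped BigOperators Real ComplexConjugate Topology Matrix
open Filter
open Literature.MathematicalPhysics.QuantumFieldTheory.BalabanImbrieJaffe1984to88.BIJ85MomentumSymbols71
open BIJ85CurlComplement719 (IsTwoForm projK projK_apply)
open BIJ85Tau2Kernel715 (enn hVec sqrtInv scl sum_norm_scl_sq)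
open BIJ85Thm711Fibrewise (Scale sigmaSym)
open Literature.MathematicalPhysics.QuantumFieldTheory.BalabanImbrieJaffe1984to88.BIJ85SigmaClosedCube
open BIJ85Thm711ClosedCube (continuousOn_form mem_regSet)
open BIJ85Eq7113Derivation (Generic rQ wE curlF qeStar qOp pNormSq energy coD bZero xVec yVec zVec cVec aOne sPar gaugeF minimiser
  qOp_minimiser)
open BIJ85Eq7113DerivationPart3 (energy_minimiser generic_scale)
open Literature.MathematicalPhysics.QuantumFieldTheory.BalabanImbrieJaffe1984to88.BIJ85Eq7113DerivationPart5

noncomputable section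

variable {d : ℕ}

/-! ## §1 The minimiser on the closed cube (p10's Part-1 formulas with the regularized symbols) -/

section Defs

variable (n M : ℕ) (p : Fin d → ℝ)

/-- `B₀ = Δ⁻¹∂^*Q^{e*}_kf` at the shift `l`, closed cube (edge weight `wC`; η = 1/n) — the curl part of the pointwise Hodge split of
`Q^{e*}_kf` (p10's `bZero` with `qeStar ↦ qeStarC`). [cite: BalabanImbrieJaffe1985, (7.1.17) p.323] -/
def bZeroC (f : Fin d → Fin d → ℂ) (m : Fin d → ℤ) (ν : Fin d) : ℂ :=
  (((lapSym ((n : ℝ)⁻¹) (shiftMom p m))⁻¹ : ℝ) : ℂ) * coD ((n : ℝ)⁻¹) p (qeStarC n p f) m ν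

/-- `x = (∂^{(1)}_ν/√φ_ν)_ν` with the closed-cube `φ^C` (p10's `xVec`). [cite: BalabanImbrieJaffe1985, (7.1.15) p.323] -/
def xVecC : Fin d → ℂ := scl (phiC n M p) (dOne p)

/-- `y = (Σ_μā_μf_{μν}/√φ_ν)_ν` with the closed-cube `a^C` (7.1.16), `φ^C` (7.1.10) (p10's `yVec`). [cite: BalabanImbrieJaffe1985, (7.1.15) p.323] -/
def yVecC (f : Fin d → Fin d → ℂ) : Fin d → ℂ := scl (phiC n M p) (hVec (aC n M p) f)

/-- `z = P_xy`, `P_x = [δ_{νκ} − x_νx̄_κ/N]` the bracket of (7.1.15) (p10's `zVec`). [cite: BalabanImbrieJaffe1985, (7.1.15) p.323] -/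
def zVecC (f : Fin d → Fin d → ℂ) : Fin d → ℂ := projK (xVecC n M p) *ᵥ yVecC n M p f

/-- `c = Φ^{−1/2}z` (p10's `cVec`). [cite: BalabanImbrieJaffe1985, (7.1.15) p.323] -/
def cVecC (f : Fin d → Fin d → ℂ) (ν : Fin d) : ℂ := sqrtInv (phiC n M p) ν * zVecC n M p f ν

/-- `A₁ = Δ⁻¹Q_k^*c` at the shift `l`, with the closed-cube bond weight `rC = u^Cv^C_ν` (p10's `aOne`). [cite: BalabanImbrieJaffe1985, (7.1.15) p.323] -/
def aOneC (f : Fin d → Fin d → ℂ) (m : Fin d → ℤ) (ν : Fin d) : ℂ :=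
  (((lapSym ((n : ℝ)⁻¹) (shiftMom p m))⁻¹ : ℝ) : ℂ) * conj (rC n p m ν) * cVecC n M p f ν

/-- `s = ⟨x, y⟩/N`, `N = Σ_ρ|∂^{(1)}_ρ|²/φ^C_ρ` (p10's `sPar`). [cite: BalabanImbrieJaffe1985, (7.1.15) p.323] -/
def sParC (f : Fin d → Fin d → ℂ) : ℂ :=
  (star (xVecC n M p) ⬝ᵥ yVecC n M p f) / ((enn (dOne p) (phiC n M p) : ℝ) : ℂ)

/-- The gauge function `λ` (supported at `l = 0`, `λ(0) = s/u^C(p′)`) restoring `Q_kA* = 0` (p10's `gaugeF`). [cite: BalabanImbrieJaffe1985, (4.2.1) p.310] -/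
def gaugeFC (f : Fin d → Fin d → ℂ) (m : Fin d → ℤ) : ℂ := if m = 0 then sParC n M p f / uC n p else 0

/-- **The minimiser `A* = B₀ − A₁ − ∂λ` of `‖∂A − Q^{e*}_kf‖²` over `{Q_kA = 0}` with the closed-cube symbols** (p10's `minimiser`,
every removable singularity of (7.1.7)–(7.1.16) filled). [cite: BalabanImbrieJaffe1985, (7.1.12) p.322] -/
def minimiserC (f : Fin d → Fin d → ℂ) (m : Fin d → ℤ) (ν : Fin d) : ℂ :=
  bZeroC n p f m ν - aOneC n M p f m ν - dSym ((n : ℝ)⁻¹) (shiftMom p m) ν * gaugeFC n M p f m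

end Defs

/-! ## §2 Agreement with p10's minimiser at the generic fibres -/

section Agreement

variable {n : ℕ} (M : ℕ) {p : Fin d → ℝ}

/-- At a generic momentum the closed-cube `Q^{e*}_kf` IS p10's (`wC = wE` off the diagonal; two-forms vanish on it).
[cite: BalabanImbrieJaffe1985, (7.1.11) p.322] -/
theorem qeStarC_eq_qeStar (hn : 0 < n) (hp : ∀ i, p i ≠ 0 ∧ |p i| ≤ π) {f : Fin d → Fin d → ℂ} (hf : IsTwoForm f) :
    qeStarC n p f = qeStar ((n : ℝ)⁻¹) p f := by
  funext m μ ν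
  unfold qeStarC qeStar
  by_cases hμν : μ = ν
  · subst hμν
    rw [twoForm_diag hf μ, mul_zero, mul_zero]
  · rw [wC_eq_wE hn hp m hμν]

/-- `B₀^C = B₀` at generic momenta. [cite: BalabanImbrieJaffe1985, (7.1.17) p.323] -/
theorem bZeroC_eq (hn : 0 < n) (hp : ∀ i, p i ≠ 0 ∧ |p i| ≤ π) {f : Fin d → Fin d → ℂ} (hf : IsTwoForm f) :
    bZeroC n p f = bZero ((n : ℝ)⁻¹) p f := by
  funext m ν
  unfold bZeroC bZero
  rw [qeStarC_eq_qeStar hn hp hf]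

/-- `x^C = x` at generic momenta (`φ^C = φ`). [cite: BalabanImbrieJaffe1985, (7.1.15) p.323] -/
theorem xVecC_eq (hn : 0 < n) (hp : ∀ i, p i ≠ 0 ∧ |p i| ≤ π) : xVecC n M p = xVec ((n : ℝ)⁻¹) M p := by
  unfold xVecC xVec
  rw [phiC_eq_phiSym hn M hp]

/-- `y^C = y` at generic momenta (`φ^C = φ`, `a^C = a`). [cite: BalabanImbrieJaffe1985, (7.1.15) p.323] -/
theorem yVecC_eq (hn : 0 < n) (hp : ∀ i, p i ≠ 0 ∧ |p i| ≤ π) (f : Fin d → Fin d → ℂ) :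
    yVecC n M p f = yVec ((n : ℝ)⁻¹) M p f := by
  unfold yVecC yVec
  rw [phiC_eq_phiSym hn M hp, aC_eq_aSym hn M hp]

/-- `z^C = z` at generic momenta. [cite: BalabanImbrieJaffe1985, (7.1.15) p.323] -/
theorem zVecC_eq (hn : 0 < n) (hp : ∀ i, p i ≠ 0 ∧ |p i| ≤ π) (f : Fin d → Fin d → ℂ) :
    zVecC n M p f = zVec ((n : ℝ)⁻¹) M p f := by
  unfold zVecC zVec
  rw [xVecC_eq M hn hp, yVecC_eq M hn hp f]

/-- `c^C = c` at generic momenta. [cite: BalabanImbrieJaffe1985, (7.1.15) p.323] -/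
theorem cVecC_eq (hn : 0 < n) (hp : ∀ i, p i ≠ 0 ∧ |p i| ≤ π) (f : Fin d → Fin d → ℂ) :
    cVecC n M p f = cVec ((n : ℝ)⁻¹) M p f := by
  funext ν
  unfold cVecC cVec
  rw [phiC_eq_phiSym hn M hp, zVecC_eq M hn hp f]

/-- `A₁^C = A₁` at generic momenta (`rC = rQ`). [cite: BalabanImbrieJaffe1985, (7.1.15) p.323] -/
theorem aOneC_eq (hn : 0 < n) (hp : ∀ i, p i ≠ 0 ∧ |p i| ≤ π) (f : Fin d → Fin d → ℂ) :
    aOneC n M p f = aOne ((n : ℝ)⁻¹) M p f := by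
  funext m ν
  unfold aOneC aOne
  rw [rC_eq_rQ hn hp m ν, cVecC_eq M hn hp f]

/-- `s^C = s` at generic momenta. [cite: BalabanImbrieJaffe1985, (7.1.15) p.323] -/
theorem sParC_eq (hn : 0 < n) (hp : ∀ i, p i ≠ 0 ∧ |p i| ≤ π) (f : Fin d → Fin d → ℂ) :
    sParC n M p f = sPar ((n : ℝ)⁻¹) M p f := by
  unfold sParC sPar
  rw [xVecC_eq M hn hp, yVecC_eq M hn hp f, phiC_eq_phiSym hn M hp]

/-- `u^C(p′) = u(p′)` at generic momenta. [cite: BalabanImbrieJaffe1985, (7.1.9) p.322] -/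
theorem uC_eq_uSym_self (hn : 0 < n) (hp : ∀ i, p i ≠ 0 ∧ |p i| ≤ π) : uC n p = uSym ((n : ℝ)⁻¹) p := by
  have h := uC_shift_eq_uSym hn hp 0
  rwa [shiftMom_zero] at h

/-- `λ^C = λ` at generic momenta. [cite: BalabanImbrieJaffe1985, (4.2.1) p.310] -/
theorem gaugeFC_eq (hn : 0 < n) (hp : ∀ i, p i ≠ 0 ∧ |p i| ≤ π) (f : Fin d → Fin d → ℂ) :
    gaugeFC n M p f = gaugeF ((n : ℝ)⁻¹) M p f := by
  funext m
  unfold gaugeFC gaugeF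
  rw [sParC_eq M hn hp f, uC_eq_uSym_self hn hp]

/-- **`A*^C = A*` at every momentum with all components non-zero** (`0 < |p′_i| ≤ π`, two-forms `f`): the closed-cube minimiser IS
p10's minimiser wherever the printed symbols make sense. [cite: BalabanImbrieJaffe1985, (7.1.12) p.322] -/
theorem minimiserC_eq_minimiser (hn : 0 < n) (hp : ∀ i, p i ≠ 0 ∧ |p i| ≤ π) {f : Fin d → Fin d → ℂ} (hf : IsTwoForm f) :
    minimiserC n M p f = minimiser ((n : ℝ)⁻¹) M p f := by
  funext m ν
  unfold minimiserC minimiser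
  rw [bZeroC_eq hn hp hf, aOneC_eq M hn hp f, gaugeFC_eq M hn hp f]

/-- Hence at generic momenta `Q^C_k(A*^C) = 0` (p10's `qOp_minimiser`; scales `η = 1/n`, `2M + 1 ≤ n`).
[cite: BalabanImbrieJaffe1985, (4.2.1) p.310] -/
theorem qOpC_minimiserC_generic (hd : 0 < d) (s : Scale) (hp : ∀ i, p i ≠ 0 ∧ |p i| ≤ π) {f : Fin d → Fin d → ℂ}
    (hf : IsTwoForm f) (ν : Fin d) : qOpC s.n s.M p (minimiserC s.n s.M p f) ν = 0 := by
  have hn : 0 < s.n := s.pos.1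
  have hG : Generic ((s.n : ℝ)⁻¹) s.M p := generic_scale hd s hp
  rw [minimiserC_eq_minimiser s.M hn hp hf, qOpC_eq_qOp hn hp, qOp_minimiser hG f ν]

/-- … and `‖∂A*^C − Q^{e*}_kf‖²_C = Re⟨f, σ^C_k(p′)f⟩` (p10's `energy_minimiser` = the (7.1.13) form, `sigmaC_form_eq`).
[cite: BalabanImbrieJaffe1985, (7.1.13) p.322] -/
theorem energyC_minimiserC_generic (hd : 0 < d) (s : Scale) (hp : ∀ i, p i ≠ 0 ∧ |p i| ≤ π) {f : Fin d → Fin d → ℂ}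
    (hf : IsTwoForm f) : energyC s.n s.M p (minimiserC s.n s.M p f) f = (tensorInner f (sigmaC s.n s.M p) f).re := by
  have hn : 0 < s.n := s.pos.1
  have hG : Generic ((s.n : ℝ)⁻¹) s.M p := generic_scale hd s hp
  have h := energy_minimiser hG hf
  rw [← sigmaC_form_eq hn s.M hp hf] at h
  have h' := congrArg Complex.re h
  rw [Complex.ofReal_re] at h'
  rw [minimiserC_eq_minimiser s.M hn hp hf, energyC_eq_energy hn hp _ hf]
  exact h'

end Agreement

/-! ## §3 Continuity in `p′` on the regular set -/

section Continuity

variable (n M : ℕ)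

/-- kernel: `p ↦ p + l` is continuous. [folklore] -/
private theorem continuous_shiftMom (m : Fin d → ℤ) : Continuous fun p : Fin d → ℝ => shiftMom p m := by
  have : (fun p : Fin d → ℝ => shiftMom p m) = fun p => p + fun i => 2 * π * (m i : ℝ) := by
    funext p i; simp [shiftMom]
  rw [this]
  exact continuous_id.add continuous_const

/-- kernel: `∂_μ(q)` is continuous in `q`. [folklore] -/
private theorem continuous_dSym (η : ℝ) (μ : Fin d) : Continuous fun q : Fin d → ℝ => dSym η q μ := by
  unfold dSym
  refine Continuous.div_const ?_ _
  refine (Complex.continuous_exp.comp ?_).sub continuous_const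
  exact continuous_const.mul (Complex.continuous_ofReal.comp (continuous_const.mul (continuous_apply μ)))

/-- kernel: `∂^{(1)}_μ(q)` is continuous in `q`. [folklore] -/
private theorem continuous_dOne (μ : Fin d) : Continuous fun q : Fin d → ℝ => dOne q μ := by
  unfold dOne
  refine (Complex.continuous_exp.comp ?_).sub continuous_const
  exact continuous_const.mul (Complex.continuous_ofReal.comp (continuous_apply μ))

/-- kernel: `Δ(q)` is continuous in `q`. [folklore] -/
private theorem continuous_lapSym (η : ℝ) : Continuous fun q : Fin d → ℝ => lapSym η q := by
  unfold lapSym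
  exact continuous_finsetSum _ fun μ _ => ((continuous_dSym η μ).norm).pow 2

/-- kernel: `z_μ(q)` is continuous in `q`. [folklore] -/
private theorem continuous_zC (μ : Fin d) : Continuous fun q : Fin d → ℝ => zC n q μ := by
  unfold zC
  exact Complex.continuous_exp.comp
    (continuous_const.mul (Complex.continuous_ofReal.comp (continuous_const.mul (continuous_apply μ))))

/-- kernel: `u^C` is continuous. [folklore] -/
private theorem continuous_uC : Continuous fun q : Fin d → ℝ => uC n q := by
  unfold uC; exact continuous_finsetProd _ fun ρ _ => continuous_vC n ρ

/-- kernel: the closed-cube bond weight is continuous in `p`. [folklore] -/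
private theorem continuous_rC (m : Fin d → ℤ) (ν : Fin d) : Continuous fun p : Fin d → ℝ => rC n p m ν := by
  unfold rC
  exact ((continuous_uC n).comp (continuous_shiftMom m)).mul ((continuous_vC n ν).comp (continuous_shiftMom m))

/-- kernel: the closed-cube edge weight is continuous in `p`. [folklore] -/
private theorem continuous_wC (m : Fin d → ℤ) (μ ν : Fin d) : Continuous fun p : Fin d → ℝ => wC n p m μ ν := by
  unfold wC qeW
  exact ((((continuous_zC n μ).comp (continuous_shiftMom m)).pow _).mul
    (((continuous_zC n ν).comp (continuous_shiftMom m)).pow _)).mul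
    (continuous_finsetProd _ fun ρ _ => (continuous_vC n ρ).comp (continuous_shiftMom m))

/-- kernel: `Δ(p + l)⁻¹` is continuous on the regular set for `|m_i| ≤ M`. [folklore] -/
private theorem continuousOn_lapInv {m : Fin d → ℤ} (hm : m ∈ lShifts d M) :
    ContinuousOn (fun p : Fin d → ℝ => (((lapSym ((n : ℝ)⁻¹) (shiftMom p m))⁻¹ : ℝ) : ℂ)) (regSet (d := d) n M) :=
  Complex.continuous_ofReal.comp_continuousOn
    (((continuous_lapSym _).comp (continuous_shiftMom m)).continuousOn.inv₀ fun _ hp => hp.1 m hm)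

/-- kernel: `a^C_μ(p′)` is continuous on the regular set. [folklore] -/
private theorem continuousOn_aC (μ : Fin d) :
    ContinuousOn (fun p : Fin d → ℝ => aC n M p μ) (regSet (d := d) n M) := by
  unfold aC
  refine (continuous_dOne μ).continuousOn.mul (Complex.continuous_ofReal.comp_continuousOn ?_)
  refine continuousOn_finsetSum _ fun m hm => ?_
  unfold aTermC
  refine ContinuousOn.mul ?_ ?_
  · exact (continuous_finsetProd _ fun ρ _ => (((continuous_vC n ρ).comp (continuous_shiftMom m)).norm).pow 2).continuousOn
  · exact ((continuous_lapSym _).comp (continuous_shiftMom m)).continuousOn.inv₀ fun p hp => hp.1 m hm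

/-- kernel: `φ^C_μ(p′)` is continuous on the regular set. [folklore] -/
private theorem continuousOn_phiC (μ : Fin d) :
    ContinuousOn (fun p : Fin d → ℝ => phiC n M p μ) (regSet (d := d) n M) := by
  unfold phiC
  refine continuousOn_finsetSum _ fun m hm => ContinuousOn.mul ?_ ?_
  · exact ((((continuous_uC n).comp (continuous_shiftMom m)).mul
      ((continuous_vC n μ).comp (continuous_shiftMom m))).norm.pow 2).continuousOn
  · exact ((continuous_lapSym _).comp (continuous_shiftMom m)).continuousOn.inv₀ fun p hp => hp.1 m hm

/-- kernel: `1/√φ^C_ν` is continuous on the regular set. [folklore] -/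
private theorem continuousOn_sqrtInv (ν : Fin d) :
    ContinuousOn (fun p : Fin d → ℝ => sqrtInv (phiC n M p) ν) (regSet (d := d) n M) := by
  unfold sqrtInv
  exact Complex.continuous_ofReal.comp_continuousOn
    (((continuousOn_phiC n M ν).sqrt).inv₀ fun p hp => (Real.sqrt_pos.mpr (hp.2.1 ν)).ne')

/-- `x^C` is continuous on the regular set. [cite: BalabanImbrieJaffe1985, (7.1.15) p.323] -/
theorem continuousOn_xVecC (ν : Fin d) :
    ContinuousOn (fun p : Fin d → ℝ => xVecC n M p ν) (regSet (d := d) n M) := by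
  unfold xVecC scl
  exact (continuousOn_sqrtInv n M ν).mul (continuous_dOne ν).continuousOn

/-- `y^C` is continuous on the regular set. [cite: BalabanImbrieJaffe1985, (7.1.15) p.323] -/
theorem continuousOn_yVecC (f : Fin d → Fin d → ℂ) (ν : Fin d) :
    ContinuousOn (fun p : Fin d → ℝ => yVecC n M p f ν) (regSet (d := d) n M) := by
  unfold yVecC scl hVec
  refine (continuousOn_sqrtInv n M ν).mul (continuousOn_finsetSum _ fun l _ => ?_)
  exact (Complex.continuous_conj.comp_continuousOn (continuousOn_aC n M l)).mul continuousOn_const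

/-- kernel: `Σ_ρ|x^C_ρ|² = N(p′) > 0` on the regular set. [folklore] -/
private theorem sum_norm_xVecC_sq {p : Fin d → ℝ} (hp : p ∈ regSet (d := d) n M) :
    ∑ ρ, ‖xVecC n M p ρ‖ ^ 2 = enn (dOne p) (phiC n M p) := by
  unfold xVecC
  exact sum_norm_scl_sq hp.2.1 (dOne p)

/-- The bracket `P_x` is continuous on the regular set (entrywise). [cite: BalabanImbrieJaffe1985, (7.1.15) p.323] -/
theorem continuousOn_projK_xVecC (ν κ : Fin d) :
    ContinuousOn (fun p : Fin d → ℝ => projK (xVecC n M p) ν κ) (regSet (d := d) n M) := by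
  simp only [projK_apply]
  refine continuousOn_const.sub (ContinuousOn.div ?_ ?_ ?_)
  · exact (continuousOn_xVecC n M ν).mul (Complex.continuous_conj.comp_continuousOn (continuousOn_xVecC n M κ))
  · exact Complex.continuous_ofReal.comp_continuousOn
      (continuousOn_finsetSum _ fun ρ _ => ((continuousOn_xVecC n M ρ).norm).pow 2)
  · intro p hp
    rw [sum_norm_xVecC_sq n M hp]
    exact_mod_cast hp.2.2.ne'

/-- `z^C` is continuous on the regular set. [cite: BalabanImbrieJaffe1985, (7.1.15) p.323] -/
theorem continuousOn_zVecC (f : Fin d → Fin d → ℂ) (ν : Fin d) :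
    ContinuousOn (fun p : Fin d → ℝ => zVecC n M p f ν) (regSet (d := d) n M) := by
  unfold zVecC
  simp only [Matrix.mulVec, dotProduct]
  exact continuousOn_finsetSum _ fun κ _ => (continuousOn_projK_xVecC n M ν κ).mul (continuousOn_yVecC n M f κ)

/-- `c^C` is continuous on the regular set. [cite: BalabanImbrieJaffe1985, (7.1.15) p.323] -/
theorem continuousOn_cVecC (f : Fin d → Fin d → ℂ) (ν : Fin d) :
    ContinuousOn (fun p : Fin d → ℝ => cVecC n M p f ν) (regSet (d := d) n M) := by
  unfold cVecC
  exact (continuousOn_sqrtInv n M ν).mul (continuousOn_zVecC n M f ν)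

/-- `A₁^C(l)` is continuous on the regular set (`|m_i| ≤ M`). [cite: BalabanImbrieJaffe1985, (7.1.15) p.323] -/
theorem continuousOn_aOneC (f : Fin d → Fin d → ℂ) {m : Fin d → ℤ} (hm : m ∈ lShifts d M) (ν : Fin d) :
    ContinuousOn (fun p : Fin d → ℝ => aOneC n M p f m ν) (regSet (d := d) n M) := by
  unfold aOneC
  exact ((continuousOn_lapInv n M hm).mul (Complex.continuous_conj.comp (continuous_rC n m ν)).continuousOn).mul
    (continuousOn_cVecC n M f ν)

/-- `B₀^C(l)` is continuous on the regular set (`|m_i| ≤ M`). [cite: BalabanImbrieJaffe1985, (7.1.17) p.323] -/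
theorem continuousOn_bZeroC (f : Fin d → Fin d → ℂ) {m : Fin d → ℤ} (hm : m ∈ lShifts d M) (ν : Fin d) :
    ContinuousOn (fun p : Fin d → ℝ => bZeroC n p f m ν) (regSet (d := d) n M) := by
  unfold bZeroC coD qeStarC
  refine (continuousOn_lapInv n M hm).mul (continuousOn_finsetSum _ fun μ _ => ?_)
  exact ((Complex.continuous_conj.comp ((continuous_dSym _ μ).comp (continuous_shiftMom m))).mul
    ((Complex.continuous_conj.comp (continuous_wC n m μ ν)).mul continuous_const)).continuousOn

/-- `s^C` is continuous on the regular set. [cite: BalabanImbrieJaffe1985, (7.1.15) p.323] -/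
theorem continuousOn_sParC (f : Fin d → Fin d → ℂ) :
    ContinuousOn (fun p : Fin d → ℝ => sParC n M p f) (regSet (d := d) n M) := by
  unfold sParC
  simp only [dotProduct, Pi.star_apply, Complex.star_def]
  refine ContinuousOn.div ?_ ?_ fun p hp => by exact_mod_cast hp.2.2.ne'
  · exact continuousOn_finsetSum _ fun i _ =>
      (Complex.continuous_conj.comp_continuousOn (continuousOn_xVecC n M i)).mul (continuousOn_yVecC n M f i)
  · unfold enn
    exact Complex.continuous_ofReal.comp_continuousOn (continuousOn_finsetSum _ fun ρ _ =>
      ((continuous_dOne ρ).norm.pow 2).continuousOn.div (continuousOn_phiC n M ρ) fun p hp => (hp.2.1 ρ).ne')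

/-- `λ^C(l)` is continuous on the regular set where `u^C(p′) ≠ 0` (the whole punctured closed cube).
[cite: BalabanImbrieJaffe1985, (4.2.1) p.310] -/
theorem continuousOn_gaugeFC (f : Fin d → Fin d → ℂ) (m : Fin d → ℤ) :
    ContinuousOn (fun p : Fin d → ℝ => gaugeFC n M p f m) {p | p ∈ regSet (d := d) n M ∧ uC n p ≠ 0} := by
  unfold gaugeFC
  by_cases hm : m = 0
  · simp only [hm, if_true]
    exact ((continuousOn_sParC n M f).mono fun p hp => hp.1).div (continuous_uC n).continuousOn fun p hp => hp.2
  · simp only [hm, if_false]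
    exact continuousOn_const

/-- **`A*^C(l)` is continuous in `p′` on the regular set where `u^C(p′) ≠ 0`** (`|m_i| ≤ M`). [cite: BalabanImbrieJaffe1985, (7.1.12) p.322] -/
theorem continuousOn_minimiserC (f : Fin d → Fin d → ℂ) {m : Fin d → ℤ} (hm : m ∈ lShifts d M) (ν : Fin d) :
    ContinuousOn (fun p : Fin d → ℝ => minimiserC n M p f m ν) {p | p ∈ regSet (d := d) n M ∧ uC n p ≠ 0} := by
  unfold minimiserC
  refine (((continuousOn_bZeroC n M f hm ν).mono fun p hp => hp.1).sub
    ((continuousOn_aOneC n M f hm ν).mono fun p hp => hp.1)).sub ?_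
  exact ((continuous_dSym _ ν).comp (continuous_shiftMom m)).continuousOn.mul (continuousOn_gaugeFC n M f m)

/-- `p′ ↦ Q^C_k(A*^C(p′))_ν` is continuous there. [cite: BalabanImbrieJaffe1985, (4.2.1) p.310] -/
theorem continuousOn_qOpC_minimiserC (f : Fin d → Fin d → ℂ) (ν : Fin d) :
    ContinuousOn (fun p : Fin d → ℝ => qOpC n M p (minimiserC n M p f) ν) {p | p ∈ regSet (d := d) n M ∧ uC n p ≠ 0} := by
  unfold qOpC
  exact continuousOn_finsetSum _ fun m hm => (continuous_rC n m ν).continuousOn.mul (continuousOn_minimiserC n M f hm ν)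

/-- `p′ ↦ ‖∂A*^C(p′) − Q^{e*}_kf‖²_C` is continuous there. [cite: BalabanImbrieJaffe1985, (7.1.12) p.322] -/
theorem continuousOn_energyC_minimiserC (f : Fin d → Fin d → ℂ) :
    ContinuousOn (fun p : Fin d → ℝ => energyC n M p (minimiserC n M p f) f) {p | p ∈ regSet (d := d) n M ∧ uC n p ≠ 0} := by
  unfold energyC pNormSq
  refine continuousOn_const.mul (continuousOn_finsetSum _ fun m hm => continuousOn_finsetSum _ fun μ _ =>
    continuousOn_finsetSum _ fun ν _ => ?_)
  refine (ContinuousOn.norm ?_).pow _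
  refine ContinuousOn.sub ?_ ?_
  · unfold curlF
    exact (((continuous_dSym _ μ).comp (continuous_shiftMom m)).continuousOn.mul (continuousOn_minimiserC n M f hm ν)).sub
      (((continuous_dSym _ ν).comp (continuous_shiftMom m)).continuousOn.mul (continuousOn_minimiserC n M f hm μ))
  · unfold qeStarC
    exact ((Complex.continuous_conj.comp (continuous_wC n m μ ν)).mul continuous_const).continuousOn

/-- The punctured closed cube lies in that set (`mem_regSet`; `u^C(p′) = Π v^C_ρ(p′) ≠ 0` by (7.1.20)).
[cite: BalabanImbrieJaffe1985, (7.1.20) p.323] -/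
theorem mem_regSet_uC {n : ℕ} (hn : 0 < n) (M : ℕ) {p : Fin d → ℝ} (hp : ∀ i, |p i| ≤ π) (hp0 : p ≠ 0) :
    p ∈ {p | p ∈ regSet (d := d) n M ∧ uC n p ≠ 0} :=
  ⟨mem_regSet hn M hp hp0, Finset.prod_ne_zero_iff.mpr fun ρ _ => vC_ne_zero hn (hp ρ)⟩

end Continuity

/-! ## §4 The density device: p10's path `fillPath p′ t` of generic momenta, `t → 0⁺` -/

section Density

variable {p : Fin d → ℝ}

/-- kernel: the path is continuous in `t`. [folklore] -/
private theorem continuous_fillPath (p : Fin d → ℝ) : Continuous (fillPath p) :=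
  continuous_pi fun i => by
    by_cases h : p i = 0
    · simp only [fillPath, h, if_true]; exact continuous_id
    · simp only [fillPath, h, if_false]; exact continuous_const

/-- kernel: the path at `t = 0` is `p`. [folklore] -/
private theorem fillPath_zero (p : Fin d → ℝ) : fillPath p 0 = p := by
  funext i
  by_cases h : p i = 0 <;> simp [fillPath, h]

/-- For `0 < t ≤ π` the path runs through GENERIC momenta of the closed cube (all components non-zero).
[cite: BalabanImbrieJaffe1985, (7.1.22) p.324] -/
theorem fillPath_generic (hp : ∀ i, |p i| ≤ π) {t : ℝ} (ht0 : 0 < t) (htπ : t ≤ π) (i : Fin d) :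
    fillPath p t i ≠ 0 ∧ |fillPath p t i| ≤ π := by
  by_cases h : p i = 0
  · simp only [fillPath, h, if_true]
    exact ⟨ht0.ne', by rw [abs_of_pos ht0]; exact htπ⟩
  · simp only [fillPath, h, if_false]
    exact ⟨h, hp i⟩

/-- For `p ≠ 0` the path never passes through `0`. [cite: BalabanImbrieJaffe1985, (7.1.22) p.324] -/
theorem fillPath_ne_zero (hp0 : p ≠ 0) (t : ℝ) : fillPath p t ≠ 0 := by
  obtain ⟨ρ, hρ⟩ := Function.ne_iff.mp hp0
  have hρ' : p ρ ≠ 0 := hρ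
  refine Function.ne_iff.mpr ⟨ρ, ?_⟩
  show fillPath p t ρ ≠ 0
  rw [fillPath, if_neg hρ']
  exact hρ'

/-- **The path tends to `p` WITHIN any set containing its generic part**, as `t → 0⁺`. [cite: BalabanImbrieJaffe1985, (7.1.22) p.324] -/
theorem tendsto_fillPath_nhdsWithin {S : Set (Fin d → ℝ)} (hS : ∀ t ∈ Set.Ioc (0 : ℝ) π, fillPath p t ∈ S) :
    Tendsto (fillPath p) (𝓝[Set.Ioc 0 π] 0) (𝓝[S] p) := by
  refine tendsto_nhdsWithin_iff.mpr ⟨?_, eventually_nhdsWithin_of_forall hS⟩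
  have h := (continuous_fillPath p).tendsto 0
  rw [fillPath_zero] at h
  exact h.mono_left nhdsWithin_le_nhds

/-- **Identities pass from the generic momenta to `p`**: two functions continuous at `p` within sets met by the path and equal along
it for `t ∈ (0, π]` agree at `p`. [cite: BalabanImbrieJaffe1985, (7.1.22) p.324] -/
theorem eq_of_fillPath {X : Type*} [TopologicalSpace X] [T2Space X] {F G : (Fin d → ℝ) → X} {S T : Set (Fin d → ℝ)}
    (hF : ContinuousWithinAt F S p) (hG : ContinuousWithinAt G T p)
    (hS : ∀ t ∈ Set.Ioc (0 : ℝ) π, fillPath p t ∈ S) (hT : ∀ t ∈ Set.Ioc (0 : ℝ) π, fillPath p t ∈ T)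
    (heq : ∀ t ∈ Set.Ioc (0 : ℝ) π, F (fillPath p t) = G (fillPath p t)) : F p = G p := by
  haveI : (𝓝[Set.Ioc (0 : ℝ) π] 0).NeBot := left_nhdsWithin_Ioc_neBot Real.pi_pos
  have h1 : Tendsto (F ∘ fillPath p) (𝓝[Set.Ioc 0 π] 0) (𝓝 (F p)) := hF.tendsto.comp (tendsto_fillPath_nhdsWithin hS)
  have h2 : Tendsto (G ∘ fillPath p) (𝓝[Set.Ioc 0 π] 0) (𝓝 (G p)) := hG.tendsto.comp (tendsto_fillPath_nhdsWithin hT)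
  exact tendsto_nhds_unique_of_eventuallyEq h1 h2 (eventually_nhdsWithin_of_forall fun t ht => heq t ht)

/-- **Inequalities pass from the generic momenta to `p`** (same setting, real-valued). [cite: BalabanImbrieJaffe1985, (7.1.22) p.324] -/
theorem le_of_fillPath {F G : (Fin d → ℝ) → ℝ} {S T : Set (Fin d → ℝ)}
    (hF : ContinuousWithinAt F S p) (hG : ContinuousWithinAt G T p)
    (hS : ∀ t ∈ Set.Ioc (0 : ℝ) π, fillPath p t ∈ S) (hT : ∀ t ∈ Set.Ioc (0 : ℝ) π, fillPath p t ∈ T)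
    (hle : ∀ t ∈ Set.Ioc (0 : ℝ) π, F (fillPath p t) ≤ G (fillPath p t)) : F p ≤ G p := by
  haveI : (𝓝[Set.Ioc (0 : ℝ) π] 0).NeBot := left_nhdsWithin_Ioc_neBot Real.pi_pos
  have h1 : Tendsto (F ∘ fillPath p) (𝓝[Set.Ioc 0 π] 0) (𝓝 (F p)) := hF.tendsto.comp (tendsto_fillPath_nhdsWithin hS)
  have h2 : Tendsto (G ∘ fillPath p) (𝓝[Set.Ioc 0 π] 0) (𝓝 (G p)) := hG.tendsto.comp (tendsto_fillPath_nhdsWithin hT)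
  exact le_of_tendsto_of_tendsto h1 h2 (eventually_nhdsWithin_of_forall fun t ht => hle t ht)

end Density

/-! ## §5 The closed-cube minimiser is constrained and realises the σ^C_k form at EVERY `p′ ≠ 0` of the closed cube -/

section Main

variable {p : Fin d → ℝ}

/-- **`Q^C_k(A*^C) = 0` at every `p′ ≠ 0` of the closed cube** (axis fibres included): the identity holds at the generic momenta
`fillPath p′ t` and both sides are continuous at `p′`. [cite: BalabanImbrieJaffe1985, (4.2.1) p.310] -/
theorem qOpC_minimiserC (hd : 0 < d) (s : Scale) (hp : ∀ i, |p i| ≤ π) (hp0 : p ≠ 0) {f : Fin d → Fin d → ℂ}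
    (hf : IsTwoForm f) (ν : Fin d) : qOpC s.n s.M p (minimiserC s.n s.M p f) ν = 0 := by
  have hn : 0 < s.n := s.pos.1
  have hpath : ∀ t ∈ Set.Ioc (0 : ℝ) π, fillPath p t ∈ {q | q ∈ regSet (d := d) s.n s.M ∧ uC s.n q ≠ 0} := fun t ht =>
    mem_regSet_uC hn s.M (fun i => (fillPath_generic hp ht.1 ht.2 i).2) (fillPath_ne_zero hp0 t)
  refine eq_of_fillPath (G := fun _ => (0 : ℂ)) (T := Set.univ)
    ((continuousOn_qOpC_minimiserC s.n s.M f ν) p (mem_regSet_uC hn s.M hp hp0)) continuousWithinAt_const hpath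
    (fun _ _ => Set.mem_univ _) fun t ht => ?_
  exact qOpC_minimiserC_generic hd s (fillPath_generic hp ht.1 ht.2) hf ν

/-- **`‖∂A*^C − Q^{e*}_kf‖²_C = Re⟨f, σ^C_k(p′)f⟩` at every `p′ ≠ 0` of the closed cube** (axis fibres included; two-forms `f`): the
identity holds at the generic momenta `fillPath p′ t`, the left side is continuous at `p′` (§3) and so is the regularized form
(p10's `continuousOn_form`). [cite: BalabanImbrieJaffe1985, (7.1.13) p.322] -/
theorem energyC_minimiserC (hd : 0 < d) (s : Scale) (hp : ∀ i, |p i| ≤ π) (hp0 : p ≠ 0) {f : Fin d → Fin d → ℂ}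
    (hf : IsTwoForm f) : energyC s.n s.M p (minimiserC s.n s.M p f) f = (tensorInner f (sigmaC s.n s.M p) f).re := by
  have hn : 0 < s.n := s.pos.1
  have hpath : ∀ t ∈ Set.Ioc (0 : ℝ) π, fillPath p t ∈ {q | q ∈ regSet (d := d) s.n s.M ∧ uC s.n q ≠ 0} := fun t ht =>
    mem_regSet_uC hn s.M (fun i => (fillPath_generic hp ht.1 ht.2 i).2) (fillPath_ne_zero hp0 t)
  refine eq_of_fillPath ((continuousOn_energyC_minimiserC s.n s.M f) p (mem_regSet_uC hn s.M hp hp0))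
    ((continuousOn_form s.n s.M f) p (mem_regSet hn s.M hp hp0)) hpath (fun t ht => (hpath t ht).1) fun t ht => ?_
  exact energyC_minimiserC_generic hd s (fillPath_generic hp ht.1 ht.2) hf

/-- **The regularized (7.1.13) form is a constrained energy at every `p′ ≠ 0` of the closed cube**: there is an η-bond field `A`
with `Q_kA = 0` and `‖∂A − Q^{e*}_kf‖²_C = Re⟨f, (τ₁^C + τ₂^C)(p′)f⟩` (the other half — no constrained field does better — is
p10's `energy_ge` transported the same way, file 3). [cite: BalabanImbrieJaffe1985, (7.1.13) p.322] -/
theorem exists_constrained_energyC_eq_form (hd : 0 < d) (s : Scale) (hp : ∀ i, |p i| ≤ π) (hp0 : p ≠ 0)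
    {f : Fin d → Fin d → ℂ} (hf : IsTwoForm f) :
    ∃ A : (Fin d → ℤ) → Fin d → ℂ, (∀ ν, qOpC s.n s.M p A ν = 0) ∧
      energyC s.n s.M p A f = (tensorInner f (sigmaC s.n s.M p) f).re :=
  ⟨minimiserC s.n s.M p f, qOpC_minimiserC hd s hp hp0 hf, energyC_minimiserC hd s hp hp0 hf⟩

end Main

end

end Literature.MathematicalPhysics.QuantumFieldTheory.BalabanImbrieJaffe1984to88.BIJ85Eq7113ClosedCubeMinimiser
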